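import Summits.PneNP.PneNP.Theorems.SzkEntropyPeaThreeNotInPCoreDefs

/-!
# Route SzkEntropy, crux `PeaThreeNotInP` (stmt-PneNP-10776), line `SketchIdeator3`, step S7:
# correctness of one Gauss–Jordan pass (registered stub `stub_pass`)

For an in-range support list `L ⊆ [a)×[b)×[c)` the pass `passN L = (r, L')` (CoreDefs §3) sweeps
the dense first flattening `D` (rows/columns = listed row/column labels, with repetitions) by the list
Gauss–Jordan sweep, keeps the `r` pivot rows and reads them back as the support list `L'` (rotated
format `b × c × r`).  We prove: `L'` is in range; `T₁ = rotT (rotT (ofSupportN b c r L'))` has rank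
`r`; and `ofSupportN a b c L = tmul P 1 1 T₁ = P * T₁` for some `P` of full column rank `r`.
Method: the list sweep is the typed sweep (`GaussRank.toState_lrun`, invariant `GaussRank.Inv`);
every vector of the row span of `D` is CONSISTENT (equal entries at equally-labelled positions); the
label map `ψ` (position ↦ column label) is linear, injective on consistent vectors, carries the pivot
rows to the rows of `T₁` and the rows of `D` to the rows of the input tensor (`pass_core` is the
abstract linear algebra).  Sources: J. von zur Gathen, J. Gerhard, *Modern Computer Algebra*, 3rd ed.,
CUP 2013, §12.1; J. A. Grochow, Y. Qiao, SIAM J. Comput. 52 (2023), §2.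
-/

noncomputable section

open Matrix
open scoped Kronecker
open _root_.Computability
open Literature.Computability.Complexity

namespace Summit.PneNP.PneNP.Cruxes.PeaThreeNotInP.TensorIsoLine

set_option linter.dupNamespace false -- `Summit.PneNP.PneNP.…`: summit = sub-problem name (D-0017 single-conjunct layout)

variable {a b c : ℕ}

/-! ### List semantics of one pass -/

/-- Entry semantics of the output list: `(j, k, t) ∈ L'` iff `t < r` and some position `n` with
column label `(j, k)` carries a `1` in the `t`-th pivot row. [folklore] -/
theorem pass_mem_passN_iff (L : List (ℕ × ℕ × ℕ)) (j k t : ℕ) :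
    (j, k, t) ∈ (passN L).2 ↔ ∃ (ht : t < (pivRows L).length) (n : ℕ)
      (hn : n < (L.map Prod.snd).length) (hn' : n < ((pivRows L)[t]).length),
      ((pivRows L)[t])[n] = 1 ∧ (L.map Prod.snd)[n] = (j, k) := by
  simp only [passN, List.mem_flatten, List.mem_mapIdx]
  constructor
  · rintro ⟨_, ⟨t', ht', rfl⟩, hp⟩
    simp only [readRow, List.mem_map, List.mem_filter, decide_eq_true_eq, Prod.mk.injEq] at hp
    obtain ⟨e, ⟨he, he1⟩, rfl, rfl, rfl⟩ := hp
    obtain ⟨n, hn, rfl⟩ := List.getElem_of_mem he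
    exact ⟨ht', n, List.lt_length_left_of_zip hn, List.lt_length_right_of_zip hn,
      by simpa [List.getElem_zip] using he1, by simp [List.getElem_zip]⟩
  · rintro ⟨ht, n, hn, hn', h1, he⟩
    refine ⟨_, ⟨t, ht, rfl⟩, ?_⟩
    simp only [readRow, List.mem_map, List.mem_filter, decide_eq_true_eq]
    refine ⟨((L.map Prod.snd)[n], ((pivRows L)[t])[n]), ⟨?_, h1⟩, by simp [he]⟩
    rw [List.mem_iff_getElem]
    exact ⟨n, by rw [List.length_zip]; exact lt_min hn hn', by simp [List.getElem_zip]⟩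

/-- **Conjunct 1**: the output list is in range for the rotated format `(b, c, r)`. [folklore] -/
theorem pass_range (L : List (ℕ × ℕ × ℕ))
    (hL : ∀ p ∈ L, p.1 < a ∧ p.2.1 < b ∧ p.2.2 < c) :
    ∀ p ∈ (passN L).2, p.1 < b ∧ p.2.1 < c ∧ p.2.2 < (passN L).1 := by
  rintro ⟨j, k, t⟩ hp
  obtain ⟨ht, n, hn, -, -, he⟩ := (pass_mem_passN_iff L j k t).1 hp
  have hmem : (j, k) ∈ L.map Prod.snd := by rw [← he]; exact List.getElem_mem hn
  obtain ⟨q, hq, hqe⟩ := List.mem_map.1 hmem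
  obtain ⟨-, hb, hc⟩ := hL q hq
  rw [hqe] at hb hc
  exact ⟨hb, hc, ht⟩

/-! ### The list sweep is the typed sweep -/

/-- Shape of the initial list state: `N` rows of length `N`, no flags. [folklore] -/
theorem pass_rows₀ (L : List (ℕ × ℕ × ℕ)) :
    ((denseRows L).map fun r => (false, r)).length = (L.map Prod.snd).length ∧
    (∀ br ∈ ((denseRows L).map fun r => (false, r)), br.2.length = (L.map Prod.snd).length) ∧
    (∀ br ∈ ((denseRows L).map fun r => (false, r)), br.1 = false) := by
  refine ⟨by simp [denseRows], fun br hbr => ?_, fun br hbr => ?_⟩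
  · simp only [denseRows, List.map_map, List.mem_map, Function.comp_apply] at hbr
    obtain ⟨i, -, rfl⟩ := hbr
    simp
  · obtain ⟨r, -, rfl⟩ := List.mem_map.1 hbr
    rfl

/-- The sweep has `N` rows, each of length `N`. [folklore] -/
theorem pass_sweep_shape (L : List (ℕ × ℕ × ℕ)) : (sweep L).length = (L.map Prod.snd).length ∧
    ∀ br ∈ sweep L, br.2.length = (L.map Prod.snd).length := by
  unfold sweep
  exact ⟨by rw [GaussRank.length_lrun, (pass_rows₀ L).1],
    GaussRank.length_of_mem_lrun (pass_rows₀ L).2.1 _⟩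

/-- The list sweep of one pass, read as a typed state, is the full typed Gauss–Jordan sweep of the
dense matrix; hence the sweep invariant holds for it. [von zur Gathen–Gerhard 2013, §12.1] -/
theorem pass_inv (L : List (ℕ × ℕ × ℕ)) :
    GaussRank.Inv (GaussRank.toState (L.map Prod.snd).length (L.map Prod.snd).length
        ((denseRows L).map fun r => (false, r))).rows (L.map Prod.snd).length
      (GaussRank.toState (L.map Prod.snd).length (L.map Prod.snd).length (sweep L)) := by
  unfold sweep
  rw [GaussRank.toState_lrun (pass_rows₀ L).1 (pass_rows₀ L).2.1 (pass_rows₀ L).2.2 _ le_rfl]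
  exact GaussRank.inv_runTo _ _

/-- Entries of the dense matrix: `D u v = 1` iff `(row label of u, column label of v) ∈ L`.
[folklore] -/
theorem pass_D_apply (L : List (ℕ × ℕ × ℕ)) (u v : Fin (L.map Prod.snd).length) :
    (GaussRank.toState (L.map Prod.snd).length (L.map Prod.snd).length
        ((denseRows L).map fun r => (false, r))).rows u v =
      if ((L[u.1]'(by simpa using u.2)).1, (L.map Prod.snd)[v.1]) ∈ L then 1 else 0 := by
  have hu : u.1 < L.length := by simpa using u.2
  have hv : v.1 < L.length := by simpa using v.2
  rw [GaussRank.toState_rows]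
  simp [denseRows, hu, hv]

/-! ### Pivot rows versus flagged rows of the sweep -/

/-- Every pivot row is a flagged row of the sweep. [folklore] -/
theorem pass_exists_of_lt (L : List (ℕ × ℕ × ℕ)) (t : ℕ) (ht : t < (pivRows L).length) :
    ∃ (i : ℕ) (hi : i < (sweep L).length),
      ((sweep L)[i]).1 = true ∧ ((sweep L)[i]).2 = (pivRows L)[t] := by
  have ht' : t < ((sweep L).filter fun br => br.1).length := by simpa [pivRows] using ht
  have hmem := List.getElem_mem ht'
  rw [List.mem_filter] at hmem
  obtain ⟨i, hi, he⟩ := List.getElem_of_mem hmem.1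
  refine ⟨i, hi, by rw [he]; exact hmem.2, ?_⟩
  rw [he]
  simp [pivRows]

/-- Every flagged row of the sweep is a pivot row. [folklore] -/
theorem pass_exists_of_piv (L : List (ℕ × ℕ × ℕ)) (i : ℕ) (hi : i < (sweep L).length)
    (hpiv : ((sweep L)[i]).1 = true) :
    ∃ (t : ℕ) (ht : t < (pivRows L).length), (pivRows L)[t] = ((sweep L)[i]).2 := by
  have hmem : ((sweep L)[i]).2 ∈ pivRows L := by
    unfold pivRows
    exact List.mem_map.2 ⟨_, List.mem_filter.2 ⟨List.getElem_mem hi, hpiv⟩, rfl⟩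
  exact List.getElem_of_mem hmem

/-- The number `r` of pivot rows is the number of flagged indices of the sweep. [folklore] -/
theorem pass_card_piv (L : List (ℕ × ℕ × ℕ)) :
    Fintype.card {i : Fin (L.map Prod.snd).length // (GaussRank.toState (L.map Prod.snd).length
      (L.map Prod.snd).length (sweep L)).piv i = true} = (passN L).1 := by
  show _ = (pivRows L).length
  have h1 : (pivRows L).length = (sweep L).countP fun br => br.1 := by
    rw [pivRows, List.length_map, List.countP_eq_length_filter]
  rw [Fintype.card_subtype, h1, GaussRank.countP_eq_card_filter (fun br : Bool × List (ZMod 2) => br.1)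
    (false, []) (sweep L) _ (pass_sweep_shape L).1]
  rfl

/-! ### Consistent vectors and the label map -/

/-- Vectors of a row span inherit CONSISTENCY (equal entries at equally-labelled positions) from
the spanning rows. [folklore] -/
theorem pass_cons_of_mem_span {ι α : Type*} {N : ℕ} (lab : Fin N → α) (D : ι → Fin N → ZMod 2)
    (hD : ∀ u v w, lab v = lab w → D u v = D u w) {x : Fin N → ZMod 2}
    (hx : x ∈ Submodule.span (ZMod 2) (Set.range D)) : ∀ v w, lab v = lab w → x v = x w := by
  induction hx using Submodule.span_induction with
  | mem x h => obtain ⟨u, rfl⟩ := h; exact hD u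
  | zero => intro v w _; rfl
  | add x y _ _ hx hy => intro v w h; simp only [Pi.add_apply, hx v w h, hy v w h]
  | smul a x _ hx => intro v w h; simp only [Pi.smul_apply, hx v w h]

section LabelMap

variable (L : List (ℕ × ℕ × ℕ))
  (ψ : (Fin (L.map Prod.snd).length → ZMod 2) →ₗ[ZMod 2] (Fin b × Fin c → ZMod 2))
  (hψ : ∀ (x : Fin (L.map Prod.snd).length → ZMod 2) (q : Fin b × Fin c), ψ x q =
    if h : (L.map Prod.snd).idxOf (q.1.val, q.2.val) < (L.map Prod.snd).length
    then x ⟨(L.map Prod.snd).idxOf (q.1.val, q.2.val), h⟩ else 0)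
include hψ

/-- The LABEL MAP `ψ` (position `v ↦` column label `cols[v]`, first occurrence; described by `hψ`)
kills only the zero vector among CONSISTENT vectors (equal entries at equally-labelled positions):
every position carries an occurring, in-range label. [folklore] -/
theorem pass_ψ_eq_zero (hL : ∀ p ∈ L, p.1 < a ∧ p.2.1 < b ∧ p.2.2 < c)
    {x : Fin (L.map Prod.snd).length → ZMod 2} (hcons : ∀ v w : Fin (L.map Prod.snd).length,
      (L.map Prod.snd)[v.1] = (L.map Prod.snd)[w.1] → x v = x w) (hx : ψ x = 0) : x = 0 := by
  funext v
  have hv : v.1 < L.length := by simpa using v.2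
  obtain ⟨-, hb, hc⟩ := hL _ (List.getElem_mem hv)
  have hcv : (L.map Prod.snd)[v.1] = ((L[v.1]).2.1, (L[v.1]).2.2) := by simp
  have h0 := congrFun hx (⟨(L[v.1]).2.1, hb⟩, ⟨(L[v.1]).2.2, hc⟩)
  rw [hψ, Pi.zero_apply] at h0
  dsimp only at h0
  split_ifs at h0 with h'
  · rw [Pi.zero_apply, ← h0]
    exact hcons _ _ (by rw [List.getElem_idxOf h', hcv])
  · exact absurd (List.idxOf_lt_length_iff.2 (hcv ▸ List.getElem_mem v.2)) h'

/-- The label map carries the `t`-th pivot row (as a vector, if consistent) to the `t`-th row of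
the un-rotated output tensor `T₁`. [folklore] -/
theorem pass_T₁_row (t : Fin (passN L).1) (ht : t.1 < (pivRows L).length)
    (hlen : ((pivRows L)[t.1]).length = (L.map Prod.snd).length)
    (hcons : ∀ v w : Fin (L.map Prod.snd).length, (L.map Prod.snd)[v.1] = (L.map Prod.snd)[w.1] →
      ((pivRows L)[t.1]).getD v 0 = ((pivRows L)[t.1]).getD w 0) :
    (rotT (rotT (ofSupportN b c (passN L).1 (passN L).2))) t =
      ψ (fun k => ((pivRows L)[t.1]).getD k 0) := by
  funext q
  rw [hψ]
  show (if (q.1.val, q.2.val, t.val) ∈ (passN L).2 then (1 : ZMod 2) else 0) = _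
  by_cases h : (L.map Prod.snd).idxOf (q.1.val, q.2.val) < (L.map Prod.snd).length
  · rw [dif_pos h]
    have hcol : (L.map Prod.snd)[(L.map Prod.snd).idxOf (q.1.val, q.2.val)] = (q.1.val, q.2.val) :=
      List.getElem_idxOf h
    have hn₀ : (L.map Prod.snd).idxOf (q.1.val, q.2.val) < ((pivRows L)[t.1]).length := hlen ▸ h
    by_cases h1 : ((pivRows L)[t.1]).getD ((L.map Prod.snd).idxOf (q.1.val, q.2.val)) 0 = 1
    · rw [h1, if_pos ((pass_mem_passN_iff _ _ _ _).2
        ⟨ht, _, h, hn₀, by rwa [List.getD_eq_getElem _ _ hn₀] at h1, hcol⟩)]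
    · obtain h0 | h0 := (by decide : ∀ z : ZMod 2, z = 0 ∨ z = 1)
        (((pivRows L)[t.1]).getD ((L.map Prod.snd).idxOf (q.1.val, q.2.val)) 0)
      · rw [h0, if_neg]; rw [pass_mem_passN_iff]
        rintro ⟨_, n, hn, hn', hn1, hne⟩
        apply h1
        have key := hcons ⟨n, hn⟩ ⟨_, h⟩ (by dsimp only; rw [hne, hcol])
        dsimp only at key
        rw [← key, List.getD_eq_getElem _ _ hn', hn1]
      · exact absurd h0 h1
  · rw [dif_neg h, if_neg]; rw [pass_mem_passN_iff]
    rintro ⟨_, n, hn, _, _, hne⟩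
    apply h
    rw [List.idxOf_lt_length_iff, ← hne]
    exact List.getElem_mem hn

variable (D : Fin (L.map Prod.snd).length → Fin (L.map Prod.snd).length → ZMod 2)
  (hD : ∀ u v, D u v =
    if ((L[u.1]'(by simpa using u.2)).1, (L.map Prod.snd)[v.1]) ∈ L then 1 else 0)
include hD

/-- The label map carries the `u`-th row of the dense matrix `D` (entries described by `hD`) to the
row of the support tensor with the `u`-th row label. [folklore] -/
theorem pass_ψ_D (u : Fin (L.map Prod.snd).length) (i : Fin a)
    (hi : (L[u.1]'(by simpa using u.2)).1 = i.val) : ψ (D u) = ofSupportN a b c L i := by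
  funext q
  rw [hψ]
  show _ = if (i.val, q.1.val, q.2.val) ∈ L then (1 : ZMod 2) else 0
  by_cases h : (L.map Prod.snd).idxOf (q.1.val, q.2.val) < (L.map Prod.snd).length
  · have hcol : (L.map Prod.snd)[(L.map Prod.snd).idxOf (q.1.val, q.2.val)] = (q.1.val, q.2.val) :=
      List.getElem_idxOf h
    rw [dif_pos h, hD]
    dsimp only
    rw [hcol, hi]
  · rw [dif_neg h, if_neg]
    intro hmem
    apply h
    rw [List.idxOf_lt_length_iff]
    exact List.mem_map.2 ⟨_, hmem, rfl⟩

/-- The label map is injective on the row span of the dense matrix (its vectors are consistent,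
as the rows of `D` are). [folklore] -/
theorem pass_ψ_injOn (hL : ∀ p ∈ L, p.1 < a ∧ p.2.1 < b ∧ p.2.2 < c) :
    Set.InjOn ψ (Submodule.span (ZMod 2) (Set.range D)) := by
  intro x hx y hy hxy
  have h0 : x - y = 0 :=
    pass_ψ_eq_zero L ψ hψ hL (pass_cons_of_mem_span (fun v => (L.map Prod.snd)[v.1]) D
      (fun u v w h => by rw [hD, hD, h]) (Submodule.sub_mem _ hx hy)) (by rw [map_sub, hxy, sub_self])
  exact sub_eq_zero.1 h0

end LabelMap

/-! ### The linear algebra of one pass -/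

/-- **The linear algebra of one pass** (abstract form).  Let `st` be the final state of the
Gauss–Jordan sweep of `D` (invariant `Inv D N st`), `ψ` a linear map injective on the row span of
`D`, `T` a matrix whose rows are exactly the `ψ`-images of the pivot rows (`r` of them) and `S` a
matrix whose rows are `0` or `ψ`-images of rows of `D`, every such image occurring.  Then
`rank T = r` and `S = P * T` for some `P` of rank `r`. [von zur Gathen–Gerhard 2013, §12.1] -/
theorem pass_core {N r m : ℕ} {β : Type*} [Fintype β] [DecidableEq β]
    (D : Fin N → Fin N → ZMod 2) (st : GaussRank.State (ZMod 2) N N)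
    (hInv : GaussRank.Inv D N st) (ψ : (Fin N → ZMod 2) →ₗ[ZMod 2] (β → ZMod 2))
    (hψ : Set.InjOn ψ (Submodule.span (ZMod 2) (Set.range D)))
    (T : Matrix (Fin r) β (ZMod 2)) (S : Matrix (Fin m) β (ZMod 2))
    (hrange : Set.range T.row = Set.range (ψ ∘ fun i : {i // st.piv i = true} => st.rows i.1))
    (hcard : Fintype.card {i // st.piv i = true} = r)
    (hS : ∀ i, S i = 0 ∨ ∃ u, S i = ψ (D u)) (hS' : ∀ u, ∃ i, ψ (D u) = S i) :
    T.rank = r ∧ ∃ P : Matrix (Fin m) (Fin r) (ZMod 2), P.rank = r ∧ S = P * T := by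
  classical
  have hspan : Submodule.span (ZMod 2) (Set.range fun i : {i // st.piv i = true} => st.rows i.1) =
      Submodule.span (ZMod 2) (Set.range D) := by
    rw [← GaussRank.span_range_eq_span_pivots hInv, hInv.span_eq]
  have hli : LinearIndependent (ZMod 2) (ψ ∘ fun i : {i // st.piv i = true} => st.rows i.1) :=
    (GaussRank.linearIndependent_pivots hInv).map_injOn ψ (by rw [hspan]; exact hψ)
  have hfin : Module.finrank (ZMod 2) (Submodule.span (ZMod 2) (Set.range T.row)) = r := by
    rw [hrange, finrank_span_eq_card hli, hcard]
  have hSspan : ∀ i, S i ∈ Submodule.span (ZMod 2) (Set.range T.row) := by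
    intro i
    rcases hS i with h0 | ⟨u, hu⟩
    · rw [h0]; exact Submodule.zero_mem _
    · rw [hu, hrange, Set.range_comp]
      apply Submodule.apply_mem_span_image_of_mem_span
      rw [hspan]
      exact Submodule.subset_span ⟨u, rfl⟩
  have hTspan : Submodule.span (ZMod 2) (Set.range T.row) ≤
      Submodule.span (ZMod 2) (Set.range S.row) := by
    rw [Submodule.span_le, hrange]
    rintro _ ⟨i, rfl⟩
    have hmem : st.rows i.1 ∈ Submodule.span (ZMod 2) (Set.range D) := by
      rw [← hInv.span_eq]; exact Submodule.subset_span ⟨i.1, rfl⟩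
    refine Submodule.span_mono ?_ (Submodule.apply_mem_span_image_of_mem_span ψ hmem)
    rintro _ ⟨_, ⟨u, rfl⟩, rfl⟩
    obtain ⟨i', hi'⟩ := hS' u
    exact ⟨i', hi'.symm⟩
  choose cf hcf using fun i => (Submodule.mem_span_range_iff_exists_fun (ZMod 2)).1 (hSspan i)
  have hSP : S = Matrix.of cf * T := by
    ext i q
    have h := congrFun (hcf i) q
    rw [Finset.sum_apply] at h
    rw [Matrix.mul_apply, ← h]
    rfl
  refine ⟨by rw [Matrix.rank_eq_finrank_span_row, hfin], Matrix.of cf,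
    le_antisymm (Matrix.rank_le_width _) ?_, hSP⟩
  calc r = Module.finrank (ZMod 2) (Submodule.span (ZMod 2) (Set.range T.row)) := hfin.symm
    _ ≤ Module.finrank (ZMod 2) (Submodule.span (ZMod 2) (Set.range S.row)) :=
      Submodule.finrank_mono hTspan
    _ = S.rank := (Matrix.rank_eq_finrank_span_row S).symm
    _ = (Matrix.of cf * T).rank := by rw [← hSP]
    _ ≤ (Matrix.of cf).rank := Matrix.rank_mul_le_left _ _

/-! ### The registered stub -/

/-- **stub (W2)**: correctness of ONE pass — for in-range input the output is in range for the rotated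
format `(b, c, r)`, the un-rotated output tensor (format `r × b × c`, rows = pivot rows of the sweep,
de-duplicated over column labels) has rank `r`, and the input tensor is `tmul P 1 1` of it for some `P`
of full column rank. [von zur Gathen–Gerhard 2013, §12.1; GrochowQiao2023, §2] -/
theorem stub_pass (a b c : ℕ) (L : List (ℕ × ℕ × ℕ))
    (hL : ∀ p ∈ L, p.1 < a ∧ p.2.1 < b ∧ p.2.2 < c) :
    (∀ p ∈ (passN L).2, p.1 < b ∧ p.2.1 < c ∧ p.2.2 < (passN L).1) ∧
    (rotT (rotT (ofSupportN b c (passN L).1 (passN L).2))).rank = (passN L).1 ∧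
    ∃ P : Matrix (Fin a) (Fin (passN L).1) (ZMod 2), P.rank = (passN L).1 ∧
      ofSupportN a b c L = tmul P 1 1 (rotT (rotT (ofSupportN b c (passN L).1 (passN L).2))) := by
  classical
  refine ⟨pass_range L hL, ?_⟩
  let ψ : (Fin (L.map Prod.snd).length → ZMod 2) →ₗ[ZMod 2] (Fin b × Fin c → ZMod 2) :=
    { toFun := fun x q => if h : (L.map Prod.snd).idxOf (q.1.val, q.2.val) < (L.map Prod.snd).length
        then x ⟨(L.map Prod.snd).idxOf (q.1.val, q.2.val), h⟩ else 0
      map_add' := fun x y => by funext q; simp only [Pi.add_apply]; split_ifs <;> simp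
      map_smul' := fun m x => by
        funext q; simp only [Pi.smul_apply, smul_eq_mul, RingHom.id_apply]; split_ifs <;> simp }
  obtain ⟨D, hD, hInv⟩ : ∃ D : Fin (L.map Prod.snd).length → Fin (L.map Prod.snd).length →
      ZMod 2, (∀ u v, D u v =
        if ((L[u.1]'(by simpa using u.2)).1, (L.map Prod.snd)[v.1]) ∈ L then 1 else 0) ∧
      GaussRank.Inv D (L.map Prod.snd).length
        (GaussRank.toState (L.map Prod.snd).length (L.map Prod.snd).length (sweep L)) :=
    ⟨_, pass_D_apply L, pass_inv L⟩
  set st := GaussRank.toState (L.map Prod.snd).length (L.map Prod.snd).length (sweep L) with hst₀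
  set T₁ := rotT (rotT (ofSupportN b c (passN L).1 (passN L).2))
  have hrow : ∀ (t : Fin (passN L).1) (ht : t.1 < (pivRows L).length)
      (i : Fin (L.map Prod.snd).length) (hi : i.1 < (sweep L).length),
      ((sweep L)[i.1]).2 = (pivRows L)[t.1] → T₁ t = ψ (st.rows i) := by
    intro t ht i hi he
    have hst : st.rows i = fun k : Fin (L.map Prod.snd).length => ((pivRows L)[t.1]).getD k 0 := by
      funext k
      rw [hst₀, GaussRank.toState_rows, List.getD_eq_getElem _ _ hi, he]
    have hlen : ((pivRows L)[t.1]).length = (L.map Prod.snd).length := by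
      rw [← he]; exact (pass_sweep_shape L).2 _ (List.getElem_mem hi)
    have hcons := pass_cons_of_mem_span (fun v => (L.map Prod.snd)[v.1]) D
      (fun u v w h => by rw [hD, hD, h])
      (x := fun k : Fin (L.map Prod.snd).length => ((pivRows L)[t.1]).getD k 0)
      (by rw [← hst, ← hInv.span_eq]; exact Submodule.subset_span ⟨i, rfl⟩)
    rw [hst]
    exact pass_T₁_row L ψ (fun _ _ => rfl) t ht hlen hcons
  have hlenS : (sweep L).length = (L.map Prod.snd).length := (pass_sweep_shape L).1
  have hrange : Set.range T₁.row =
      Set.range (ψ ∘ fun i : {i // st.piv i = true} => st.rows i.1) := by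
    ext x
    constructor
    · rintro ⟨t, rfl⟩
      have ht : t.1 < (pivRows L).length := t.2
      obtain ⟨i, hi, hpiv, he⟩ := pass_exists_of_lt L t.1 ht
      refine ⟨⟨⟨i, hlenS ▸ hi⟩, ?_⟩, (hrow t ht ⟨i, _⟩ hi he).symm⟩
      rw [hst₀, GaussRank.toState_piv, List.getD_eq_getElem _ _ hi, hpiv]
    · rintro ⟨⟨i, hpiv⟩, rfl⟩
      have hi : i.1 < (sweep L).length := by rw [hlenS]; exact i.2
      have hpiv' : ((sweep L)[i.1]).1 = true := by
        rwa [hst₀, GaussRank.toState_piv, List.getD_eq_getElem _ _ hi] at hpiv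
      obtain ⟨t, ht, he⟩ := pass_exists_of_piv L i.1 hi hpiv'
      exact ⟨⟨t, ht⟩, hrow ⟨t, ht⟩ ht i hi he.symm⟩
  have hS' : ∀ u : Fin (L.map Prod.snd).length, ∃ i : Fin a, ψ (D u) = ofSupportN a b c L i := by
    intro u
    have hu : u.1 < L.length := by simpa using u.2
    exact ⟨⟨(L[u.1]).1, (hL _ (List.getElem_mem hu)).1⟩,
      pass_ψ_D L ψ (fun _ _ => rfl) D hD u _ rfl⟩
  have hS : ∀ i : Fin a, ofSupportN a b c L i = 0 ∨ ∃ u, ofSupportN a b c L i = ψ (D u) := by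
    intro i
    by_cases h : ∃ u : Fin (L.map Prod.snd).length, (L[u.1]'(by simpa using u.2)).1 = i.val
    · obtain ⟨u, hu⟩ := h
      exact Or.inr ⟨u, (pass_ψ_D L ψ (fun _ _ => rfl) D hD u i hu).symm⟩
    · left
      funext q
      show (if (i.val, q.1.val, q.2.val) ∈ L then (1 : ZMod 2) else 0) = 0
      rw [if_neg]
      intro hmem
      obtain ⟨k, hk, he⟩ := List.getElem_of_mem hmem
      exact h ⟨⟨k, by simpa using hk⟩, by simp [he]⟩
  obtain ⟨hrank, P, hP, hSP⟩ := pass_core D st hInv ψ (pass_ψ_injOn L ψ (fun _ _ => rfl) D hD hL)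
    T₁ (ofSupportN a b c L) hrange (pass_card_piv L) hS hS'
  refine ⟨hrank, P, hP, ?_⟩
  rw [hSP, tmul, Matrix.one_kronecker_one, Matrix.transpose_one, Matrix.mul_one]

end Summit.PneNP.PneNP.Cruxes.PeaThreeNotInP.TensorIsoLine

end
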